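import Summits.QuantumAdvantage.AdviceFreeQNC0.LogDegreeResidueBalance
import Summits.QuantumAdvantage.AdviceFreeQNC0.ProductGame
import HarnessLib

/-!
# Cell qa-qnc0 (rung F-Q1, route RingFrame, crux α `RingToElim`): the residue classes of the
# Hamming weight mod 3 are balanced on every LEVEL SET of a few low-degree features
# (Viola–Wigderson budget)

For `K` Boolean features `φ_k : {0,1}^L → {0,1}` of `𝔽₂`-degree `≤ d` and a target `α ∈ {0,1}^K`,
the ATOM `A_α = {x : φ_k(x) = α_k ∀ k}` satisfies

  `‖Σ_{x ∈ A_α} (−1)^{g(x)} ω^{|x|}‖ ≤ 2^L · e^{−3L/(8·4^d)}`   (`ω = e^{2πi/3}`, any twist `g` of degree `≤ d`)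

(`norm_levelSet_twistedSum_le`; induction on the constraints: `1[φ = t]·(−1)^g = ½((−1)^g ± (−1)^{g+φ})`
and `g + φ` has degree `≤ d` again; the base case is the Viola–Wigderson bound of the tree,
`norm_sum_signChar_mul_omega3_pow_le`).  Hence every residue class `|x| ≡ r (mod 3)` carries at
least `#A_α/3 − (2/3)·2^L·e^{−3L/(8·4^d)}` points of the atom (`levelSet_class_ge`,
`atom_class_ge`), and the `≤ 2^K` atoms of one feature map lose at most `(2/3)·2^K·2^L·e^{−3L/(8·4^d)}`
rows in total — at most `2^L/12` under the budget `2·4^d·(K+3) ≤ L` (`two_pow_mul_vwErr_le`).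

This is the balance input of the K-feature window theorem AT THE VIOLA–WIGDERSON BUDGET
(`LowDegFeatureWindow.lean`): for features of CONSTANT degree `d` the admissible number of
features is LINEAR in `L` (`K ≤ L/(2·4^d) − 3`), where the PLDAMS route of `KFeatureWindow.lean`
(atoms as arbitrary sets of degree `K·D`) stops at `K·D ≲ √L` (`PLDAMSFence*.lean`).  No conflict with
that fence: its witness is a symmetric polynomial of degree `≍ √(L·log(1/κ))`, not a level set of
constant-degree features.  The cell's lemma (prover qn-prover-3 gen 5, 2026-08-27); the engine is
[ViolaWigderson2008, Thm 2.9] as vendored in the tree.  WHAT THIS IS NOT: nothing for features of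
polylog degree (there `e^{−3L/(8·4^d)}` is useless and PLDAMS remains the tool); nothing on α.

## References

* E. Viola, A. Wigderson, *Norms, XOR lemmas, and lower bounds for polynomials and protocols*,
  Theory of Computing 4 (2008), Thm. 2.9 [ViolaWigderson2008].
-/

noncomputable section

namespace Summit.QuantumAdvantage.AdviceFreeQNC0

open Finset
open Literature.Computability.MetaComplexity Literature.Computability.MetaComplexity.Smolensky
open Literature.Computability.MetaComplexity.GowersCube

variable {L : ℕ}

/-! ### The Viola–Wigderson error and the budget -/

/-- The Viola–Wigderson error at degree `d` on `L` bits: `ε_d(L) = e^{−3L/(8·4^d)}`. [folklore] -/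
def vwErr (L d : ℕ) : ℝ := Real.exp (-(3 * (L : ℝ) / (8 * 4 ^ d)))

/-- `ε_d(L) > 0`. [folklore] -/
theorem vwErr_pos (L d : ℕ) : 0 < vwErr L d := Real.exp_pos _

/-- **The budget.**  If `2·4^d·(K+3) ≤ L` then `2^K · ε_d(L) ≤ 1/8` (uses `log 2 ≤ 3/4`). [folklore] -/
theorem two_pow_mul_vwErr_le {K d : ℕ} (h : 2 * 4 ^ d * (K + 3) ≤ L) :
    (2 : ℝ) ^ K * vwErr L d ≤ 1 / 8 := by
  have hlog2 : Real.log 2 ≤ 3 / 4 := by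
    have := Real.log_two_lt_d9
    linarith
  have hlog2pos : 0 < Real.log 2 := Real.log_pos (by norm_num)
  have h4d : (0 : ℝ) < 4 ^ d := by positivity
  have hL : (2 : ℝ) * 4 ^ d * (K + 3) ≤ L := by exact_mod_cast h
  -- `(K + 3)·log 2 ≤ 3L/(8·4^d)`
  have hkey : ((K : ℝ) + 3) * Real.log 2 ≤ 3 * (L : ℝ) / (8 * 4 ^ d) := by
    rw [le_div_iff₀ (by positivity)]
    have hK : (0 : ℝ) ≤ (K : ℝ) + 3 := by positivity
    have h1 : ((K : ℝ) + 3) * Real.log 2 * (8 * 4 ^ d) ≤ ((K : ℝ) + 3) * (3 / 4) * (8 * 4 ^ d) :=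
      mul_le_mul_of_nonneg_right (mul_le_mul_of_nonneg_left hlog2 hK) (by positivity)
    have h2 : ((K : ℝ) + 3) * (3 / 4) * (8 * 4 ^ d) = 3 * (2 * 4 ^ d * ((K : ℝ) + 3)) := by ring
    have h3 : 3 * (2 * 4 ^ d * ((K : ℝ) + 3)) ≤ 3 * (L : ℝ) := by linarith
    linarith
  have h2K : (2 : ℝ) ^ K = Real.exp ((K : ℝ) * Real.log 2) := by
    rw [← Real.exp_log (by norm_num : (0 : ℝ) < 2), ← Real.exp_nat_mul, Real.exp_log (by norm_num : (0 : ℝ) < 2)]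
  have h8 : (1 : ℝ) / 8 = Real.exp (-(3 * Real.log 2)) := by
    rw [Real.exp_neg]
    have : Real.exp (3 * Real.log 2) = 8 := by
      have h := Real.exp_nat_mul (Real.log 2) 3
      rw [Real.exp_log (by norm_num : (0 : ℝ) < 2)] at h
      norm_num at h ⊢
      exact_mod_cast h
    rw [this, one_div]
  rw [h2K, vwErr, ← Real.exp_add, h8, Real.exp_le_exp]
  linarith

/-! ### Indicators and level sets -/

/-- `HasDeg φ d` says exactly that the indicator `indZ φ` (`ProductGame.lean`) lies in `lowDeg d`. -/
theorem indZ_mem_lowDeg_of_hasDeg {d : ℕ} {φ : (Fin L → Bool) → Bool} (hφ : HasDeg φ d) :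
    indZ φ ∈ lowDeg (ZMod 2) L d := hφ

/-- The level set cut out by a list of (feature, target) constraints. -/
def levelSet (l : List (((Fin L → Bool) → Bool) × Bool)) : Finset (Fin L → Bool) :=
  univ.filter fun x => ∀ e ∈ l, e.1 x = e.2

/-- No constraint: the whole cube. -/
theorem levelSet_nil : levelSet ([] : List (((Fin L → Bool) → Bool) × Bool)) = univ := by
  unfold levelSet
  exact Finset.filter_true_of_mem fun x _ e he => by simp at he

/-- One more constraint: filter the level set. -/
theorem levelSet_cons (e : ((Fin L → Bool) → Bool) × Bool) (l : List (((Fin L → Bool) → Bool) × Bool)) :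
    levelSet (e :: l) = (levelSet l).filter fun x => e.1 x = e.2 := by
  unfold levelSet
  rw [Finset.filter_filter]
  refine Finset.filter_congr fun x _ => ?_
  simp only [List.forall_mem_cons]
  tauto

/-- Every element of `ZMod 2` is `0` or `1`. [folklore] -/
private theorem zmod2_cases (a : ZMod 2) : a = 0 ∨ a = 1 := by
  fin_cases a
  · exact Or.inl rfl
  · exact Or.inr rfl

/-- The sign of a target bit: `τ_t = (−1)^t`. -/
private def sgn (t : Bool) : ℂ := if t then -1 else 1

/-- `‖τ_t‖ = 1`. -/
private theorem norm_sgn (t : Bool) : ‖sgn t‖ = 1 := by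
  unfold sgn; cases t <;> simp

/-- **The splitting identity**: `1[φ x = t]·(−1)^{g x} = ½·((−1)^{g x} + τ_t·(−1)^{(g + 1_φ) x})`. -/
private theorem indicator_mul_signChar (φ : (Fin L → Bool) → Bool) (t : Bool) (g : CubeFn (ZMod 2) L)
    (x : Fin L → Bool) :
    (if φ x = t then signChar (g x) else 0) =
      (1 / 2 : ℂ) * signChar (g x) + (sgn t / 2) * signChar ((g + indZ φ) x) := by
  rw [Pi.add_apply, signChar_add]
  unfold indZ sgn
  rcases zmod2_cases (g x) with h | h <;> rw [h] <;> cases φ x <;> cases t <;> simp <;> ring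

/-! ### Twisted character sums over level sets -/

/-- **Twisted character sums over a level set of low-degree features are small.**  For a list
`l` of constraints `φ = t` with every `φ` of degree `≤ d`, and every twist `g` of degree `≤ d`:
`‖Σ_{x ∈ levelSet l} (−1)^{g x} ω^{|x|}‖ ≤ 2^L · e^{−3L/(8·4^d)}`.
[cite: ViolaWigderson2008, Theorem 2.9 (applied at ζ = ω, iterated over the constraints)] -/
theorem norm_levelSet_twistedSum_le {d : ℕ} (l : List (((Fin L → Bool) → Bool) × Bool))
    (hl : ∀ e ∈ l, HasDeg e.1 d) {g : CubeFn (ZMod 2) L} (hg : g ∈ lowDeg (ZMod 2) L d) :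
    ‖∑ x ∈ levelSet l, signChar (g x) * omega3 ^ wt x‖ ≤ (2 : ℝ) ^ L * vwErr L d := by
  induction l generalizing g with
  | nil =>
    rw [levelSet_nil]
    exact norm_sum_signChar_mul_omega3_pow_le hg
  | cons e l ih =>
    have hl' : ∀ e' ∈ l, HasDeg e'.1 d := fun e' he' => hl e' (List.mem_cons_of_mem _ he')
    have he : HasDeg e.1 d := hl e List.mem_cons_self
    have hg' : g + indZ e.1 ∈ lowDeg (ZMod 2) L d := Submodule.add_mem _ hg (indZ_mem_lowDeg_of_hasDeg he)
    rw [levelSet_cons, Finset.sum_filter]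
    have key : ∀ x : Fin L → Bool,
        (if e.1 x = e.2 then signChar (g x) * omega3 ^ wt x else 0) =
          (1 / 2 : ℂ) * (signChar (g x) * omega3 ^ wt x) +
            (sgn e.2 / 2) * (signChar ((g + indZ e.1) x) * omega3 ^ wt x) := by
      intro x
      have h := indicator_mul_signChar e.1 e.2 g x
      by_cases hx : e.1 x = e.2
      · rw [if_pos hx] at h ⊢
        rw [← mul_assoc, ← mul_assoc, ← add_mul, ← h]
      · rw [if_neg hx] at h ⊢
        have h' : (0 : ℂ) * omega3 ^ wt x =
            ((1 / 2 : ℂ) * signChar (g x) + sgn e.2 / 2 * signChar ((g + indZ e.1) x)) * omega3 ^ wt x := by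
          rw [← h]
        rw [zero_mul] at h'
        rw [← mul_assoc, ← mul_assoc, ← add_mul]
        exact h'
    rw [Finset.sum_congr rfl fun x _ => key x, Finset.sum_add_distrib, ← Finset.mul_sum, ← Finset.mul_sum]
    have h1 := ih hl' hg
    have h2 := ih hl' hg'
    calc ‖(1 / 2 : ℂ) * ∑ x ∈ levelSet l, signChar (g x) * omega3 ^ wt x +
          sgn e.2 / 2 * ∑ x ∈ levelSet l, signChar ((g + indZ e.1) x) * omega3 ^ wt x‖
        ≤ ‖(1 / 2 : ℂ) * ∑ x ∈ levelSet l, signChar (g x) * omega3 ^ wt x‖ +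
          ‖sgn e.2 / 2 * ∑ x ∈ levelSet l, signChar ((g + indZ e.1) x) * omega3 ^ wt x‖ := norm_add_le _ _
      _ = (1 / 2) * ‖∑ x ∈ levelSet l, signChar (g x) * omega3 ^ wt x‖ +
          (1 / 2) * ‖∑ x ∈ levelSet l, signChar ((g + indZ e.1) x) * omega3 ^ wt x‖ := by
          have ha : ‖(1 / 2 : ℂ)‖ = 1 / 2 := by norm_num
          have hb : ‖sgn e.2 / 2‖ = 1 / 2 := by rw [norm_div, norm_sgn]; norm_num
          rw [norm_mul, norm_mul, ha, hb]
      _ ≤ (1 / 2) * ((2 : ℝ) ^ L * vwErr L d) + (1 / 2) * ((2 : ℝ) ^ L * vwErr L d) := by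
          gcongr
      _ = (2 : ℝ) ^ L * vwErr L d := by ring

/-- The untwisted sum: `‖Σ_{x ∈ levelSet l} ω^{|x|}‖ ≤ 2^L · e^{−3L/(8·4^d)}`.
[cite: ViolaWigderson2008, Theorem 2.9 (applied at ζ = ω)] -/
theorem norm_levelSet_charSum_le {d : ℕ} (l : List (((Fin L → Bool) → Bool) × Bool))
    (hl : ∀ e ∈ l, HasDeg e.1 d) :
    ‖∑ x ∈ levelSet l, omega3 ^ wt x‖ ≤ (2 : ℝ) ^ L * vwErr L d := by
  have h := norm_levelSet_twistedSum_le l hl (g := 0) (Submodule.zero_mem _)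
  simpa only [Pi.zero_apply, signChar_zero, one_mul] using h

/-! ### Class counts on level sets -/

/-- **Every residue class holds almost a third of a low-degree level set**:
`#{x ∈ levelSet l : |x| ≡ r (3)} ≥ #(levelSet l)/3 − (2/3)·2^L·e^{−3L/(8·4^d)}`.
[cite: ViolaWigderson2008, Theorem 2.9 (applied at ζ = ω)] -/
theorem levelSet_class_ge {d : ℕ} (l : List (((Fin L → Bool) → Bool) × Bool))
    (hl : ∀ e ∈ l, HasDeg e.1 d) (r : ℕ) :
    ((levelSet l).card : ℝ) / 3 - 2 / 3 * ((2 : ℝ) ^ L * vwErr L d) ≤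
      (((levelSet l).filter fun x => wt x % 3 = r % 3).card : ℝ) := by
  have h1 : |(3 : ℝ) * (((levelSet l).filter fun x => wt x % 3 = r % 3).card : ℝ) - ((levelSet l).card : ℝ)| ≤
      2 * ‖∑ x ∈ levelSet l, omega3 ^ wt x‖ :=
    abs_three_mul_card_filter_mod_sub_card_le (levelSet l) r
  have h2 := norm_levelSet_charSum_le l hl
  have h3 := (abs_le.1 h1).1
  linarith

/-- The atom of a feature map `φ : Fin K → ({0,1}^L → Bool)` at `α` is the level set of the list
of constraints `(φ k, α k)`. -/
theorem filter_features_eq_levelSet {K : ℕ} (φ : Fin K → (Fin L → Bool) → Bool) (α : Fin K → Bool) :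
    (univ.filter fun x : Fin L → Bool => (fun k => φ k x) = α) =
      levelSet (List.ofFn fun k => (φ k, α k)) := by
  unfold levelSet
  refine Finset.filter_congr fun x _ => ?_
  rw [List.forall_mem_ofFn_iff]
  constructor
  · intro h k
    exact congrFun h k
  · intro h
    funext k
    exact h k

/-- **Atoms of `K` features of degree `≤ d` are balanced mod 3**: for every target `α` and
residue `r`, `#{x : φ(x) = α, |x| ≡ r (3)} ≥ #{x : φ(x) = α}/3 − (2/3)·2^L·e^{−3L/(8·4^d)}`.
[cite: ViolaWigderson2008, Theorem 2.9 (applied at ζ = ω)] -/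
theorem atom_class_ge {K d : ℕ} (φ : Fin K → (Fin L → Bool) → Bool) (hφ : ∀ k, HasDeg (φ k) d)
    (α : Fin K → Bool) (r : ℕ) :
    ((univ.filter fun x : Fin L → Bool => (fun k => φ k x) = α).card : ℝ) / 3 -
        2 / 3 * ((2 : ℝ) ^ L * vwErr L d) ≤
      (((univ.filter fun x : Fin L → Bool => (fun k => φ k x) = α).filter
        fun x => wt x % 3 = r % 3).card : ℝ) := by
  rw [filter_features_eq_levelSet]
  refine levelSet_class_ge _ (fun e he => ?_) r
  rw [List.mem_ofFn] at he
  obtain ⟨k, rfl⟩ := he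
  exact hφ k

/-- The number of atoms of a `K`-feature map is at most `2^K`. [folklore] -/
theorem card_image_features_le {K : ℕ} (Ψ : (Fin L → Bool) → (Fin K → Bool)) :
    (((univ : Finset (Fin L → Bool)).image Ψ).card : ℝ) ≤ (2 : ℝ) ^ K := by
  have h : ((univ : Finset (Fin L → Bool)).image Ψ).card ≤ (univ : Finset (Fin K → Bool)).card :=
    Finset.card_le_card (Finset.subset_univ _)
  rw [Finset.card_univ, Fintype.card_fun, Fintype.card_bool, Fintype.card_fin] at h
  exact_mod_cast h

end Summit.QuantumAdvantage.AdviceFreeQNC0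

end
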